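import Summits.MatrixMultiplication.OmegaCensus.SmallFormats.BoxCertificate
import Mathlib.Algebra.Group.Nat.Even
import HarnessLib

/-!
# ω-census family (a): `BoxCert` branch-and-bound certificates with parity leaves

Cell `pub-omega` (unit `pub-omega-tensor-g11`), topic `Summits/MatrixMultiplication/OmegaCensus` (sub-folder `SmallFormats`).
Framing (verbatim): lottery ticket; floor = certified bounds/negative ranges. HONEST FRAMING: generic bookkeeping, no matrix
multiplication content. This is the certificate format of `BoxCertificate` (`leaf` = Lagrangian weak-duality bound from nonnegative
multipliers, `infeasible` = a row violated on the whole box, `branch`) with ONE new leaf kind: `parity i` closes a box in which the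
four variables of the `i`-th quadruple of a fixed table `ParityData` are all fixed (`lo = hi`) to values with ODD sum. Soundness
(`CertP.sum_lt_of_check`) is therefore relative to the side hypothesis `ParityData.OK x` ("every listed quadruple of `x` has even sum"),
which the consumer must discharge (for the slack-4 X-cap system over `𝔽₅` it is the rectangle-parity lemma of LP-tight points,
`MatMul22nRankGF5XCapParity`). Everything else (`System`, boxes, `leafOK`, `rowInfeasible` and their soundness) is reused verbatim.
-/

namespace Summit.MatrixMultiplication.OmegaCensus.SmallFormats.BoxCert

open Finset

/-- Parity side information: `nrect` quadruples of variable indices, `rq i = (a, b, c, d)`. -/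
structure ParityData where
  /-- number of quadruples -/
  nrect : ℕ
  /-- the `i`-th quadruple -/
  rq : ℕ → ℕ × ℕ × ℕ × ℕ

/-- `x` has even sum on every listed quadruple. -/
def ParityData.OK (P : ParityData) (x : ℕ → ℕ) : Prop :=
  ∀ i < P.nrect, Even (x (P.rq i).1 + x (P.rq i).2.1 + x (P.rq i).2.2.1 + x (P.rq i).2.2.2)

/-- Branch-and-bound certificates with parity leaves. -/
inductive CertP where
  /-- pruned by multipliers `y` (numerators over the common denominator `D`) -/
  | leaf (y : ℕ → ℕ) : CertP
  /-- pruned because row `r` is violated by every point of the box -/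
  | infeasible (r : ℕ) : CertP
  /-- pruned because quadruple `i` is fixed by the box to values with odd sum -/
  | parity (i : ℕ) : CertP
  /-- split on `x j ≥ v + 1` (first child) versus `x j ≤ v` (second child) -/
  | branch (j v : ℕ) (up down : CertP) : CertP

variable (S : System) (P : ParityData)

/-- The parity-leaf test: quadruple `i` exists, its four variables are fixed by the box, and the fixed values have odd sum. -/
def ParityData.leafOK (s i : ℕ) (path : List (ℕ × ℕ × ℕ)) : Bool :=
  decide (i < P.nrect) &&
    (decide (loOf path (P.rq i).1 = hiOf s path (P.rq i).1) &&
    (decide (loOf path (P.rq i).2.1 = hiOf s path (P.rq i).2.1) &&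
    (decide (loOf path (P.rq i).2.2.1 = hiOf s path (P.rq i).2.2.1) &&
    (decide (loOf path (P.rq i).2.2.2 = hiOf s path (P.rq i).2.2.2) &&
    decide ((loOf path (P.rq i).1 + loOf path (P.rq i).2.1 + loOf path (P.rq i).2.2.1 + loOf path (P.rq i).2.2.2) % 2 = 1)))))

/-- The certificate checker (pure `ℕ/ℤ` arithmetic, meant for `decide +kernel`). -/
def CertP.check (D T s : ℕ) : CertP → List (ℕ × ℕ × ℕ) → Bool
  | .leaf y, path => S.leafOK D T s y path
  | .infeasible r, path => decide (r < S.M) && S.rowInfeasible s r path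
  | .parity i, path => P.leafOK s i path
  | .branch j v up dn, path =>
      decide (loOf path j ≤ v) && decide (v < hiOf s path j) &&
        up.check D T s ((j, v + 1, hiOf s path j) :: path) && dn.check D T s ((j, loOf path j, v) :: path)

/-- A variable fixed by the box (`lo = hi`) equals `lo`. -/
theorem eq_loOf_of_inBox {s : ℕ} {path : List (ℕ × ℕ × ℕ)} {x : ℕ → ℕ} (hbox : InBox s path x) {j : ℕ}
    (h : loOf path j = hiOf s path j) : x j = loOf path j :=
  le_antisymm (h ▸ (hbox j).2) (hbox j).1

/-- **Parity-leaf soundness**: no point of the box has even sum on the fixed odd quadruple. -/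
theorem ParityData.false_of_leafOK {s i : ℕ} {path : List (ℕ × ℕ × ℕ)} (h : P.leafOK s i path = true) {x : ℕ → ℕ}
    (hbox : InBox s path x) (hpar : P.OK x) : False := by
  simp only [ParityData.leafOK, Bool.and_eq_true, decide_eq_true_eq] at h
  obtain ⟨hi, h1, h2, h3, h4, hodd⟩ := h
  have hev := hpar i hi
  rw [eq_loOf_of_inBox hbox h1, eq_loOf_of_inBox hbox h2, eq_loOf_of_inBox hbox h3, eq_loOf_of_inBox hbox h4] at hev
  obtain ⟨k, hk⟩ := hev
  omega

/-- **Soundness of the checker** (relative to the parity side hypothesis `P.OK x`). -/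
theorem CertP.sum_lt_of_check (hwf : S.ColWF) {D T s : ℕ} :
    ∀ (c : CertP) (path : List (ℕ × ℕ × ℕ)), c.check S P D T s path = true →
      ∀ x : ℕ → ℕ, InBox s path x → S.Feasible x → P.OK x → ∑ j ∈ range S.N, x j < T
  | .leaf y, path, h, x, hbox, hfeas, _ => S.sum_lt_of_leafOK hwf (by simpa [CertP.check] using h) hbox hfeas
  | .infeasible r, path, h, x, hbox, hfeas, _ => by
      simp only [CertP.check, Bool.and_eq_true, decide_eq_true_eq] at h
      exact (S.false_of_rowInfeasible h.1 h.2 hbox hfeas).elim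
  | .parity i, path, h, x, hbox, _, hpar => by
      simp only [CertP.check] at h
      exact (P.false_of_leafOK h hbox hpar).elim
  | .branch j v up dn, path, h, x, hbox, hfeas, hpar => by
      simp only [CertP.check, Bool.and_eq_true, decide_eq_true_eq] at h
      obtain ⟨⟨⟨_, _⟩, hup⟩, hdn⟩ := h
      rcases Nat.lt_or_ge v (x j) with hv | hv
      · exact CertP.sum_lt_of_check hwf up _ hup x (inBox_up hbox hv) hfeas hpar
      · exact CertP.sum_lt_of_check hwf dn _ hdn x (inBox_down hbox hv) hfeas hpar

/-- **Root form**: a passing certificate at the root box bounds every feasible, parity-OK `x ≤ s` by `∑_{j<N} x j < T`. -/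
theorem CertP.sum_lt_of_check_root (hwf : S.ColWF) {D T s : ℕ} (c : CertP) (h : c.check S P D T s [] = true)
    (x : ℕ → ℕ) (hx : ∀ j, x j ≤ s) (hfeas : S.Feasible x) (hpar : P.OK x) : ∑ j ∈ range S.N, x j < T :=
  CertP.sum_lt_of_check S P hwf c [] h x (inBox_nil hx) hfeas hpar

/-- Assembly step for certificate skeletons: a branch node passes if its side conditions hold and both children pass. -/
theorem CertP.check_branch {D T s j v : ℕ} {up dn : CertP} {path : List (ℕ × ℕ × ℕ)}
    (h1 : loOf path j ≤ v) (h2 : v < hiOf s path j)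
    (hu : up.check S P D T s ((j, v + 1, hiOf s path j) :: path) = true)
    (hd : dn.check S P D T s ((j, loOf path j, v) :: path) = true) :
    (CertP.branch j v up dn).check S P D T s path = true := by
  simp [CertP.check, h1, h2, hu, hd]

/-! ## A toy instance (format check): `x₀ + x₁ ≤ 1` on `[0,1]²` with the quadruple `(0,0,1,1)` (so `2x₀ + 2x₁` even — vacuous);
claim `∑ < 2` by one multiplier leaf. -/

/-- Toy parity table. -/
def toyP : ParityData := ⟨1, fun _ => (0, 0, 1, 1)⟩

/-- The toy certificate passes. -/
example : (CertP.leaf fun _ => 1).check toy toyP 1 2 1 [] = true := by decide +kernel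

end Summit.MatrixMultiplication.OmegaCensus.SmallFormats.BoxCert
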